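import Literature.Geometry.Manifold.LieGroupExponential
import HarnessLib

/-!
# The exponential map of an additive Lie group (additive transport of `LieGroupExponential`)

Mathlib's `GroupLieAlgebra` file develops left-invariant vector fields for multiplicative AND
additive Lie groups (`mulInvariantVectorField` / `addInvariantVectorField`, via `to_additive`).
`Literature.Geometry.Manifold.LieGroupExponential` builds the exponential map `lieExp : 𝔤 → G` of a
multiplicative Lie group `LieGroup I ∞ G` (Lee 2012, Thm. 9.18, Thm. 20.1, Prop. 20.5, Prop. 20.8).
This file transports every result to **additive** Lie groups `LieAddGroup I ∞ G` (vector groups,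
tori `V/Λ`, the complex points of abelian varieties, …) with Mathlib's `to_additive` machinery
applied after the fact (`attribute [to_additive …]`); six statements are proved by hand and
registered with `to_additive existing`: the two that mention a private auxiliary of the
multiplicative file (`lieAddExpCurve_zero`, `isMIntegralCurve_lieAddExpCurve`), the two whose
multiplicative proofs use `mulInvariantVectorField_smul` (its additive companion
`addInvariantVectorField_smul` is hand-written in Mathlib and not registered: `lieAddExpCurve_smul`,
`lieAddExpCurve_zero_left`), and `lieAddExp_zero`.

Main additive declarations (namespace `Literature.Geometry.Manifold`): the one-parameter subgroup
`lieAddExpCurve v : ℝ → G` of `v ∈ AddGroupLieAlgebra I G = T_0 G` and the exponential map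
`lieAddExp v = lieAddExpCurve v 1`, with `exists_isMIntegralCurve_addInvariantVectorField`
(completeness, Lee Thm. 9.18), `lieAddExpCurve_add : lieAddExpCurve v (s + t) = lieAddExpCurve v s +
lieAddExpCurve v t` (Thm. 20.1), `lieAddExpCurve_eq_lieAddExp_smul` (Prop. 20.5),
`contMDiff_lieAddExp`, `mfderiv_lieAddExp_zero`, `isLocalDiffeomorphAt_lieAddExp`,
`range_lieAddExp_mem_nhds_zero`, `addSubgroupClosure_range_lieAddExp` (Prop. 20.8, Prop. 7.14),
`lieAddExp_add : lieAddExp (v + w) = lieAddExp v + lieAddExp w` for `AddCommGroup G`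
(Problem 20-8) and naturality `map_lieAddExp` under differentiable `AddMonoidHom`s (Prop. 20.8 (g));
`exists_nhds_injOn_lieAddExp`, `eventually_lieAddExp_eq_zero_imp_eq_zero`, `isOpenMap_lieAddExp`
and `lieAddExp_surjective` (connected commutative `G`, Lee Problem 21-20 (a)).

## References

* J. M. Lee, *Introduction to Smooth Manifolds*, 2nd ed., GTM 218 (2012), Thm. 9.18, Thm. 20.1,
  Prop. 20.5, Prop. 20.8, Prop. 7.14, Problem 20-8. [LeeSmoothManifolds2013]
-/

open scoped Manifold ContDiff Topology
open Set Function Filter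

noncomputable section

namespace Literature.Geometry.Manifold

universe u

/-! ### Left-invariant vector fields and translations -/

attribute [to_additive /-- The left-invariant vector field generated by `v ∈ T_0 G` of an additive
Lie group takes the value `v` at `0`. [cite: LeeSmoothManifolds2013, Thm. 8.37] -/]
  mulInvariantVectorField_one

attribute [to_additive /-- Left translation `x ↦ g + x` maps the left-invariant field at `h` to the
left-invariant field at `g + h`. [cite: LeeSmoothManifolds2013, Thm. 8.37] -/]
  mfderiv_mul_left_mulInvariantVectorField

attribute [to_additive /-- Left translations of an additive Lie group carry integral curves of a
left-invariant vector field to integral curves (on a set). [cite: LeeSmoothManifolds2013, Prop. 9.6] -/]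
  isMIntegralCurveOn_mul_left

attribute [to_additive /-- Left translations of an additive Lie group carry global integral curves of
a left-invariant vector field to global integral curves. [cite: LeeSmoothManifolds2013, Prop. 9.6] -/]
  isMIntegralCurve_mul_left

attribute [to_additive /-- Left translations of an additive Lie group carry local integral curves of
a left-invariant vector field to local integral curves. [cite: LeeSmoothManifolds2013, Prop. 9.6] -/]
  isMIntegralCurveAt_mul_left

attribute [to_additive /-- A left-invariant vector field of a `C^∞` additive Lie group is a `C^∞`
section of the tangent bundle. [cite: LeeSmoothManifolds2013, Prop. 8.33] -/]
  contMDiff_mulInvariantVectorField_infty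

attribute [to_additive contMDiff_addInvariantVectorField_one /-- A left-invariant vector field of an
additive Lie group is a `C^1` section of the tangent bundle. [cite: LeeSmoothManifolds2013, Prop. 8.33] -/]
  contMDiff_mulInvariantVectorField_one

/-! ### Completeness (Lee 2012, Thm. 9.18) and the one-parameter subgroups (Thm. 20.1) -/

attribute [to_additive /-- **Left-invariant vector fields of an additive Lie group are complete**
(Lee 2012, Thm. 9.18): through every point there is an integral curve of `addInvariantVectorField v`
defined on all of `ℝ`. [cite: LeeSmoothManifolds2013, Thm. 9.18] -/]
  exists_isMIntegralCurve_mulInvariantVectorField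

attribute [to_additive lieAddExpCurve /-- **The one-parameter subgroup generated by `v ∈ T_0 G`** of
an additive Lie group: the integral curve of `addInvariantVectorField v` through `0`, defined on all
of `ℝ` (chosen by `Classical.epsilon`). [cite: LeeSmoothManifolds2013, Thm. 20.1] -/]
  lieExpCurve

attribute [to_additive lieAddExp /-- **The exponential map** `exp : T_0 G → G` of an additive Lie
group: `exp v = γ_v(1)`. [cite: LeeSmoothManifolds2013, Ch. 20, "The Exponential Map" (p. 547)] -/]
  lieExp

section Spec

variable {E : Type u} [NormedAddCommGroup E] [NormedSpace ℝ E]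
  {H : Type*} [TopologicalSpace H] {I : ModelWithCorners ℝ E H}
  {G : Type*} [TopologicalSpace G] [ChartedSpace H G] [AddGroup G] [LieAddGroup I ∞ G]
  [CompleteSpace E] [T2Space G] [BoundarylessManifold I G]

/-- The defining property of `lieAddExpCurve v`. [cite: LeeSmoothManifolds2013, Thm. 20.1] -/
private theorem lieAddExpCurve_spec (v : AddGroupLieAlgebra I G) :
    lieAddExpCurve v 0 = 0 ∧ IsMIntegralCurve (lieAddExpCurve v) (addInvariantVectorField v) :=
  @Classical.epsilon_spec (ℝ → G)
    (fun γ => γ 0 = 0 ∧ IsMIntegralCurve γ (addInvariantVectorField v))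
    (exists_isMIntegralCurve_addInvariantVectorField v 0)

/-- The one-parameter subgroup of an additive Lie group generated by `v` starts at `0`.
[cite: LeeSmoothManifolds2013, Thm. 20.1] -/
@[simp] theorem lieAddExpCurve_zero (v : AddGroupLieAlgebra I G) : lieAddExpCurve v 0 = 0 :=
  (lieAddExpCurve_spec v).1

/-- The one-parameter subgroup of an additive Lie group generated by `v` is a global integral curve
of `addInvariantVectorField v`. [cite: LeeSmoothManifolds2013, Thm. 20.1] -/
theorem isMIntegralCurve_lieAddExpCurve (v : AddGroupLieAlgebra I G) :
    IsMIntegralCurve (lieAddExpCurve v) (addInvariantVectorField v) :=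
  (lieAddExpCurve_spec v).2

end Spec

attribute [to_additive existing lieAddExpCurve_zero] lieExpCurve_zero
attribute [to_additive existing isMIntegralCurve_lieAddExpCurve] isMIntegralCurve_lieExpCurve

attribute [to_additive eq_add_lieAddExpCurve_of_isMIntegralCurve /-- The flow of a left-invariant
field of an additive Lie group is translation by the one-parameter subgroup: every global integral
curve `γ` of `addInvariantVectorField v` is `t ↦ γ 0 + lieAddExpCurve v t`.
[cite: LeeSmoothManifolds2013, Prop. 20.8 (h)] -/]
  eq_mul_lieExpCurve_of_isMIntegralCurve

attribute [to_additive eq_lieAddExpCurve_of_isMIntegralCurve /-- Uniqueness: a global integral curve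
of `addInvariantVectorField v` through `0` is `lieAddExpCurve v`. [cite: LeeSmoothManifolds2013, Thm. 20.1] -/]
  eq_lieExpCurve_of_isMIntegralCurve

attribute [to_additive eqOn_add_lieAddExpCurve_of_isMIntegralCurveOn /-- An integral curve of
`addInvariantVectorField v` on an open interval about `0` agrees there with
`t ↦ γ 0 + lieAddExpCurve v t`. [cite: LeeSmoothManifolds2013, Thm. 9.12 (a)] -/]
  eqOn_mul_lieExpCurve_of_isMIntegralCurveOn

attribute [to_additive lieAddExpCurve_add /-- **One-parameter subgroups of an additive Lie group are
homomorphisms**: `γ_v(s + t) = γ_v(s) + γ_v(t)`. [cite: LeeSmoothManifolds2013, Thm. 20.1] -/]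
  lieExpCurve_add

attribute [to_additive lieAddExpCurve_neg /-- `γ_v(-t) = -γ_v(t)`. [cite: LeeSmoothManifolds2013, Prop. 20.8 (c)] -/]
  lieExpCurve_neg

attribute [to_additive lieAddExpCurve_add_comm /-- The values of a one-parameter subgroup of an
additive Lie group commute. [cite: LeeSmoothManifolds2013, Thm. 20.1] -/]
  lieExpCurve_mul_comm

section Smul

variable {E : Type u} [NormedAddCommGroup E] [NormedSpace ℝ E]
  {H : Type*} [TopologicalSpace H] {I : ModelWithCorners ℝ E H}
  {G : Type*} [TopologicalSpace G] [ChartedSpace H G] [AddGroup G] [LieAddGroup I ∞ G]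
  [CompleteSpace E] [T2Space G] [BoundarylessManifold I G]

/-- **Rescaling** for additive Lie groups: the one-parameter subgroup generated by `c • v` is
`t ↦ γ_v(c t)` (hand-written: the multiplicative proof uses `mulInvariantVectorField_smul`, whose
additive companion `addInvariantVectorField_smul` is not registered with `to_additive`).
[cite: LeeSmoothManifolds2013, Prop. 20.5 (proof)] -/
theorem lieAddExpCurve_smul (c : ℝ) (v : AddGroupLieAlgebra I G) (t : ℝ) :
    lieAddExpCurve (c • v) t = lieAddExpCurve v (c * t) := by
  have h1 : IsMIntegralCurve (fun t => lieAddExpCurve v (t * c)) (c • addInvariantVectorField v) :=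
    (isMIntegralCurve_lieAddExpCurve v).comp_mul c
  rw [← addInvariantVectorField_smul] at h1
  have h2 := eq_lieAddExpCurve_of_isMIntegralCurve h1 (by simp)
  have h3 : lieAddExpCurve v (t * c) = lieAddExpCurve (c • v) t := congrFun h2 t
  rw [← h3, mul_comm]

/-- The one-parameter subgroup of an additive Lie group generated by `0` is constant.
[cite: LeeSmoothManifolds2013, Thm. 20.1] -/
@[simp] theorem lieAddExpCurve_zero_left (t : ℝ) :
    lieAddExpCurve (0 : AddGroupLieAlgebra I G) t = 0 := by
  have h : IsMIntegralCurve (fun _ : ℝ => (0 : G))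
      (addInvariantVectorField (0 : AddGroupLieAlgebra I G)) := by
    apply isMIntegralCurve_const
    have h0 : addInvariantVectorField (0 : AddGroupLieAlgebra I G) = 0 := by
      simpa using addInvariantVectorField_smul (I := I) (G := G) (0 : ℝ) 0
    rw [h0]
    rfl
  have h2 := eq_lieAddExpCurve_of_isMIntegralCurve h rfl
  exact (congrFun h2 t).symm

end Smul

attribute [to_additive existing lieAddExpCurve_smul] lieExpCurve_smul
attribute [to_additive existing lieAddExpCurve_zero_left] lieExpCurve_zero_left

/-! ### The exponential map (Prop. 20.5, Prop. 20.8) -/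

section ExpZero

variable {E : Type u} [NormedAddCommGroup E] [NormedSpace ℝ E]
  {H : Type*} [TopologicalSpace H] {I : ModelWithCorners ℝ E H}
  {G : Type*} [TopologicalSpace G] [ChartedSpace H G] [AddGroup G] [LieAddGroup I ∞ G]
  [CompleteSpace E] [T2Space G] [BoundarylessManifold I G]

/-- `exp 0 = 0` for an additive Lie group. [cite: LeeSmoothManifolds2013, Prop. 20.8] -/
@[simp] theorem lieAddExp_zero : lieAddExp (0 : AddGroupLieAlgebra I G) = 0 :=
  lieAddExpCurve_zero_left 1

end ExpZero

attribute [to_additive existing lieAddExp_zero] lieExp_zero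

attribute [to_additive lieAddExpCurve_eq_lieAddExp_smul /-- **Lee 2012, Prop. 20.5** (additive):
`t ↦ exp (t • v)` is the one-parameter subgroup generated by `v`. [cite: LeeSmoothManifolds2013, Prop. 20.5] -/]
  lieExpCurve_eq_lieExp_smul

attribute [to_additive lieAddExp_add_smul /-- `exp ((s + t) • v) = exp (s • v) + exp (t • v)`.
[cite: LeeSmoothManifolds2013, Prop. 20.8 (b)] -/]
  lieExp_add_smul

attribute [to_additive lieAddExp_smul_add_comm /-- `exp (s • v)` and `exp (t • v)` commute
(additively). [cite: LeeSmoothManifolds2013, Prop. 20.8 (b)] -/]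
  lieExp_smul_mul_comm

attribute [to_additive lieAddExp_neg /-- `exp (-v) = -(exp v)`. [cite: LeeSmoothManifolds2013, Prop. 20.8 (c)] -/]
  lieExp_neg

attribute [to_additive lieAddExp_natCast_smul /-- `exp (n • v) = n • exp v` for `n : ℕ`.
[cite: LeeSmoothManifolds2013, Prop. 20.8 (d)] -/]
  lieExp_natCast_smul

attribute [to_additive lieAddExp_intCast_smul /-- `exp (n • v) = n • exp v` for `n : ℤ`.
[cite: LeeSmoothManifolds2013, Prop. 20.8 (d)] -/]
  lieExp_intCast_smul

/-! ### Derivatives and smoothness (Prop. 20.8 (a), (e), (f), (h)) -/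

attribute [to_additive hasMFDerivAt_lieAddExpCurve /-- The one-parameter subgroup `γ_v` has
velocity `X_v(γ_v t)` at time `t`. [cite: LeeSmoothManifolds2013, Thm. 20.1] -/]
  hasMFDerivAt_lieExpCurve

attribute [to_additive hasMFDerivAt_lieAddExpCurve_zero /-- Initial velocity: `γ_v'(0) = v`.
[cite: LeeSmoothManifolds2013, Prop. 20.8 (e)] -/]
  hasMFDerivAt_lieExpCurve_zero

attribute [to_additive contMDiff_add_lieAddExpCurve /-- Joint smoothness of the flow
`(g, t) ↦ g + exp (t • v)` of a left-invariant vector field of an additive Lie group.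
[cite: LeeSmoothManifolds2013, Prop. 20.8 (h)] -/]
  contMDiff_mul_lieExpCurve

attribute [to_additive contMDiff_lieAddExpCurve /-- The one-parameter subgroup `t ↦ exp (t • v)` is
a `C^∞` curve. [cite: LeeSmoothManifolds2013, Prop. 20.8 (a)] -/]
  contMDiff_lieExpCurve

attribute [to_additive continuous_lieAddExpCurve /-- The one-parameter subgroup `t ↦ exp (t • v)`
is continuous. [cite: LeeSmoothManifolds2013, Prop. 20.8 (a)] -/]
  continuous_lieExpCurve

attribute [to_additive /-- The left-invariant vector fields of an additive Lie group depend smoothly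
on the generator: `(g, v) ↦ X_v(g) ∈ TG` is `C^∞`. [cite: LeeSmoothManifolds2013, Prop. 20.8 (a) (proof)] -/]
  contMDiff_mulInvariantVectorField_prod

attribute [to_additive contMDiff_addExpField /-- Lee's auxiliary vector field
`Ξ(g, v) = (X_v(g), 0)` on `G × T_0 G` (additive Lie group) is a `C^∞` section.
[cite: LeeSmoothManifolds2013, Prop. 20.8 (a) (proof)] -/]
  contMDiff_expField

attribute [to_additive isMIntegralCurve_addExpField /-- The flow of `Ξ`:
`t ↦ (g + exp (t • v), v)` is a global integral curve of `Ξ` (additive Lie group).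
[cite: LeeSmoothManifolds2013, Prop. 20.8 (a) (proof)] -/]
  isMIntegralCurve_expField

attribute [to_additive contMDiff_lieAddExpCurve_uncurry /-- The exponential map of an additive Lie
group is jointly smooth in the generator and the time: `(v, t) ↦ exp (t • v)` is `C^∞`.
[cite: LeeSmoothManifolds2013, Prop. 20.8 (a)] -/]
  contMDiff_lieExpCurve_uncurry

attribute [to_additive contMDiff_lieAddExp /-- **The exponential map of an additive Lie group is
smooth** (Lee 2012, Prop. 20.8 (a)). [cite: LeeSmoothManifolds2013, Prop. 20.8 (a)] -/]
  contMDiff_lieExp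

attribute [to_additive continuous_lieAddExp /-- The exponential map of an additive Lie group is
continuous. [cite: LeeSmoothManifolds2013, Prop. 20.8 (a)] -/]
  continuous_lieExp

attribute [to_additive mfderiv_lieAddExp_zero_apply /-- `(d exp)_0 w = w` for an additive Lie group.
[cite: LeeSmoothManifolds2013, Prop. 20.8 (e)] -/]
  mfderiv_lieExp_zero_apply

attribute [to_additive mfderiv_lieAddExp_zero /-- **`(d exp)_0 = id`** for an additive Lie group.
[cite: LeeSmoothManifolds2013, Prop. 20.8 (e)] -/]
  mfderiv_lieExp_zero

attribute [to_additive hasMFDerivAt_lieAddExp_zero /-- `exp` of an additive Lie group has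
differential the identity at `0`. [cite: LeeSmoothManifolds2013, Prop. 20.8 (e)] -/]
  hasMFDerivAt_lieExp_zero

attribute [to_additive isLocalDiffeomorphAt_lieAddExp /-- **Canonical coordinates**: `exp` of an
additive Lie group is a `C^∞` local diffeomorphism at `0` (Lee 2012, Prop. 20.8 (f)).
[cite: LeeSmoothManifolds2013, Prop. 20.8 (f)] -/]
  isLocalDiffeomorphAt_lieExp

attribute [to_additive range_lieAddExp_mem_nhds_zero /-- `exp` of an additive Lie group is onto a
neighbourhood of `0`: `range exp ∈ 𝓝 0`. [cite: LeeSmoothManifolds2013, Prop. 20.8 (f)] -/]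
  range_lieExp_mem_nhds_one

attribute [to_additive addSubgroupClosure_range_lieAddExp /-- `exp` generates a connected additive
Lie group: the additive subgroup generated by `exp (T_0 G)` is `⊤`.
[cite: LeeSmoothManifolds2013, Prop. 7.14 and Prop. 20.8 (f)] -/]
  subgroupClosure_range_lieExp

/-! ### Commutative additive Lie groups (Problem 20-8) and naturality (Prop. 20.8 (g)) -/

attribute [to_additive /-- In a commutative additive Lie group
the differential of addition adds left-invariant vectors: `d(+)_{(a,b)}(X_v(a), X_w(b)) = X_{v+w}(a+b)`.
[cite: LeeSmoothManifolds2013, Problem 20-8] -/]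
  mfderiv_mul_mulInvariantVectorField

attribute [to_additive lieAddExpCurve_add_left /-- In a commutative additive Lie group,
`γ_{v+w}(t) = γ_v(t) + γ_w(t)`. [cite: LeeSmoothManifolds2013, Problem 20-8] -/]
  lieExpCurve_add_left

attribute [to_additive lieAddExp_add /-- **`exp (v + w) = exp v + exp w` in a commutative additive
Lie group**: `exp : (T_0 G, +) → G` is an additive homomorphism. [cite: LeeSmoothManifolds2013, Problem 20-8] -/]
  lieExp_add

attribute [to_additive lieAddExp_sub /-- `exp (v - w) = exp v - exp w` in a commutative additive Lie
group. [cite: LeeSmoothManifolds2013, Problem 20-8] -/]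
  lieExp_sub

attribute [to_additive /-- A differentiable additive
group homomorphism intertwines the left-invariant fields: `dΦ_g (X_v(g)) = X_{dΦ_0 v}(Φ g)`.
[cite: LeeSmoothManifolds2013, Thm. 8.44] -/]
  mfderiv_monoidHom_mulInvariantVectorField

attribute [to_additive map_lieAddExpCurve /-- Naturality of one-parameter subgroups of additive Lie
groups under differentiable homomorphisms: `Φ (exp (t • v)) = exp (t • dΦ_0 v)`.
[cite: LeeSmoothManifolds2013, Prop. 20.8 (g)] -/]
  map_lieExpCurve

attribute [to_additive map_lieAddExp /-- **Naturality of the exponential map** of additive Lie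
groups: `Φ (exp v) = exp (dΦ_0 v)` for a differentiable `AddMonoidHom` `Φ`.
[cite: LeeSmoothManifolds2013, Prop. 20.8 (g)] -/]
  map_lieExp

/-! ### Connected commutative additive Lie groups (Lee 2012, Problem 21-20 (a)) -/

attribute [to_additive exists_nhds_injOn_lieAddExp /-- `exp` of an additive Lie group is injective
on a neighbourhood of `0`. [cite: LeeSmoothManifolds2013, Prop. 20.8 (f)] -/]
  exists_nhds_injOn_lieExp

attribute [to_additive eventually_lieAddExp_eq_zero_imp_eq_zero /-- The kernel of `exp` of an
additive Lie group is discrete at `0`: near `0`, `exp v = 0` only for `v = 0`.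
[cite: LeeSmoothManifolds2013, Prop. 20.8 (f)] -/]
  eventually_lieExp_eq_one_imp_eq_zero

attribute [to_additive lieAddExp_surjective /-- **The exponential map of a connected commutative
additive Lie group is surjective**: `exp : T_0 G → G` is onto (Lee 2012, Problem 21-20 (a)).
[cite: LeeSmoothManifolds2013, Problem 21-20 (a)] -/]
  lieExp_surjective

attribute [to_additive isOpenMap_lieAddExp /-- **`exp` of a commutative additive Lie group is an
open map** (open at `0` by Prop. 20.8 (f), transported by `exp (v + h) = exp v + exp h`).
[cite: LeeSmoothManifolds2013, Prop. 20.8 (f)] -/]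
  isOpenMap_lieExp

end Literature.Geometry.Manifold
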